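import Mathlib
import HarnessLib
import Literature.Probability.Percolation.BlockResampling
import Literature.Probability.Percolation.SharpnessDCTProofs
import Literature.Probability.Percolation.TreeGraphBound

/-!
# Crux `PercTreeValue.TetrahedronHarrisGap` (stmt-CriticalPhenomena-7799), line `SketchIdeator1`
# (closed-collar total covariance, rev 7) — stub `stub_offCollarIdentity`

Helper file for the crux skeleton `Cruxes/TetrahedronHarrisGap/Lines/SketchIdeator1.lean`
(lead prover-line-stmt-CriticalPhenomena-7799-c3-0, skeleton rev 7),
`--supports stmt-CriticalPhenomena-7799`.  No new definitions; everything is stated in the tree's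
vocabulary (`blockCondProb`, `obs`, `openConn`, `openConnIn`, `openGraph`).

The registered stub `stub_offCollarIdentity` is the pointwise heart of the rev-7 composition: the
written-out conditional probability given the configuration off a finite block `K` of pairs is
`blockCondProb G p K E ω = P_p{ζ | ω ∖ K ∪ obs ζ K ∈ E}` (`blockCondProb_eq_real`).  If `K` contains
no pair inside `R` and no pair inside `U`, then for a configuration `ω` with `x ↔ a` inside `R` and
`b ↔ c` inside `U`, EVERY glued configuration `ξ = ω ∖ K ∪ obs ζ K` agrees with `ω` on `R.sym2` and
on `U.sym2` (`sdiff_union_inter_eq_of_disjoint`), hence still has `x ↔ a` inside `R` and `b ↔ c`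
inside `U` (`{x ↔ a in R}` is determined by the pairs inside `R`, `DCT16.determinedBy_openConnIn`).
In the open graph of `ξ` therefore `x ~ a` and `b ~ c`, so that `a ~ c ⟺ x ~ b ⟺ (x ~ b ∧ a ~ c)` by
transitivity and symmetry of reachability (`reachable_iff_of_reachable`).  Consequently the three
sets `{ζ | ξ ∈ {a ↔ c}}`, `{ζ | ξ ∈ {x ↔ b}}`, `{ζ | ξ ∈ {x ↔ b} ∩ {a ↔ c}}` coincide and so do the
three block-conditional probabilities.
-/

noncomputable section

open MeasureTheory Literature.Probability.Percolation Literature.Probability.LatticeModels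

namespace Summit.CriticalPhenomena.PercolationContinuityZ3.Theorems.TetrahedronHarrisGap

/-- **Gluing on a block disjoint from `F` does not change the configuration on `F`.**  If the set
of pairs `K` is disjoint from `F` and `T ⊆ K`, then `(ω ∖ K ∪ T) ∩ F = ω ∩ F`. -/
theorem sdiff_union_inter_eq_of_disjoint {V : Type*} {K F T : Set (Sym2 V)}
    (hK : Disjoint K F) (hT : T ⊆ K) (ω : BondConfig V) :
    (ω \ K ∪ T) ∩ F = ω ∩ F := by
  ext e
  simp only [Set.mem_inter_iff, Set.mem_union, Set.mem_sdiff]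
  constructor
  · rintro ⟨h | h, he⟩
    · exact ⟨h.1, he⟩
    · exact absurd he (Set.disjoint_left.1 hK (hT h))
  · rintro ⟨hω, he⟩
    exact ⟨Or.inl ⟨hω, fun heK => Set.disjoint_left.1 hK heK he⟩, he⟩

/-- **The glued configuration keeps a restricted connection.**  If the block `K` contains no pair
inside `R` (`Disjoint K R.sym2`) and `T ⊆ K`, then `ω ∈ {x ↔ a in R}` implies
`ω ∖ K ∪ T ∈ {x ↔ a in R}`: the event `{x ↔ a in R}` is determined by the pairs inside `R`
(`DCT16.determinedBy_openConnIn`), on which the two configurations agree. -/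
theorem sdiff_union_mem_openConnIn {V : Type*} {K T : Set (Sym2 V)} {R : Set V} {x a : V}
    (hK : Disjoint K R.sym2) (hT : T ⊆ K) {ω : BondConfig V} (hω : ω ∈ openConnIn R x a) :
    ω \ K ∪ T ∈ openConnIn R x a :=
  ((determinedBy_iff _ _).1 (DCT16.determinedBy_openConnIn R x a Set.Subset.rfl) _ _
    (sdiff_union_inter_eq_of_disjoint hK hT ω)).2 hω

/-- **Crossed connections through two frozen links.**  In a graph with `x ~ a` and `b ~ c`
(reachability), `a ~ c ⟺ x ~ b`. -/
theorem reachable_iff_of_reachable {V : Type*} {H : SimpleGraph V} {x a b c : V}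
    (hxa : H.Reachable x a) (hbc : H.Reachable b c) : H.Reachable a c ↔ H.Reachable x b :=
  ⟨fun h => hxa.trans (h.trans hbc.symm), fun h => hxa.symm.trans (h.trans hbc)⟩

/-- **In every glued configuration the two restricted connections survive.**  For `K` disjoint
from `R.sym2` and from `U.sym2` and `ω ∈ {x ↔ a in R} ∩ {b ↔ c in U}`, the open graph of
`ω ∖ K ∪ obs ζ K` has `x ~ a` and `b ~ c` for every `ζ`. -/
theorem reachable_sdiff_union_obs {V : Type*} {K : Finset (Sym2 V)} {R U : Set V} {x a b c : V}
    (hR : Disjoint (↑K : Set (Sym2 V)) R.sym2) (hU : Disjoint (↑K : Set (Sym2 V)) U.sym2)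
    {ω : BondConfig V} (hω : ω ∈ openConnIn R x a ∩ openConnIn U b c) (ζ : BondConfig V) :
    (openGraph (ω \ ↑K ∪ ↑(obs ζ K))).Reachable x a ∧
      (openGraph (ω \ ↑K ∪ ↑(obs ζ K))).Reachable b c :=
  ⟨openConnIn_subset_openConn R x a
      (sdiff_union_mem_openConnIn hR (Finset.coe_subset.2 (obs_subset ζ K)) hω.1),
    openConnIn_subset_openConn U b c
      (sdiff_union_mem_openConnIn hU (Finset.coe_subset.2 (obs_subset ζ K)) hω.2)⟩

/-- **stub_offCollarIdentity** (registered stub of line `SketchIdeator1`, rev 7): if the finite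
block `K` contains no pair inside `R` and no pair inside `U`, then on `{x ↔ a in R} ∩ {b ↔ c in U}`
the block-conditional probabilities of `{a ↔ c}`, `{x ↔ b}` and `{x ↔ b} ∩ {a ↔ c}` COINCIDE:
every glued configuration `ω ∖ K ∪ obs ζ K` keeps the two restricted connections
(`reachable_sdiff_union_obs`), and then `x ↔ b ⟺ a ↔ c ⟺ both` by transitivity of `↔`
(`reachable_iff_of_reachable`, `blockCondProb_eq_real`). -/
theorem stub_offCollarIdentity :
    ∀ {V : Type*} [Countable V] (G : SimpleGraph V) (p : unitInterval) (K : Finset (Sym2 V)) (R U : Set V)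
      (x a b c : V), Disjoint (↑K : Set (Sym2 V)) R.sym2 → Disjoint (↑K : Set (Sym2 V)) U.sym2 →
      ∀ ω ∈ openConnIn R x a ∩ openConnIn U b c,
        blockCondProb G p K (openConn a c) ω = blockCondProb G p K (openConn x b) ω ∧
        blockCondProb G p K (openConn x b ∩ openConn a c) ω = blockCondProb G p K (openConn x b) ω := by
  intro V _ G p K R U x a b c hR hU ω hω
  simp only [blockCondProb_eq_real]
  refine ⟨congrArg (bondPercolation G p).real (Set.ext fun ζ => ?_),
    congrArg (bondPercolation G p).real (Set.ext fun ζ => ?_)⟩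
  · show (openGraph (ω \ ↑K ∪ ↑(obs ζ K))).Reachable a c ↔
      (openGraph (ω \ ↑K ∪ ↑(obs ζ K))).Reachable x b
    exact reachable_iff_of_reachable (reachable_sdiff_union_obs hR hU hω ζ).1
      (reachable_sdiff_union_obs hR hU hω ζ).2
  · show (openGraph (ω \ ↑K ∪ ↑(obs ζ K))).Reachable x b ∧
        (openGraph (ω \ ↑K ∪ ↑(obs ζ K))).Reachable a c ↔
      (openGraph (ω \ ↑K ∪ ↑(obs ζ K))).Reachable x b
    exact ⟨fun h => h.1, fun h => ⟨h, (reachable_iff_of_reachable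
      (reachable_sdiff_union_obs hR hU hω ζ).1 (reachable_sdiff_union_obs hR hU hω ζ).2).2 h⟩⟩

end Summit.CriticalPhenomena.PercolationContinuityZ3.Theorems.TetrahedronHarrisGap

end
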